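import Literature.Probability.Distributions.GaussianSphereMarginal
import Literature.Probability.Distributions.BetaGammaRatioTV
import Literature.MeasureTheory.TotalVariation.SetwiseBound
import Mathlib.Analysis.SpecialFunctions.Gaussian.FourierTransform
import HarnessLib

/-!
# The sphere marginal versus the standard Gaussian in total variation (Diaconis–Freedman)

`Literature/Probability/Distributions/`. For independent standard Gaussian vectors `x ∼ γ_{E₁}`,
`z ∼ γ_F` of real inner product spaces of dimensions `k = dim E₁`, `m = dim F ≥ 3`, `d = k + m`, and
`b = x/√(‖x‖² + ‖z‖²)` (`sphereMarginalMap E₁ F (x, z)`, sibling file `GaussianSphereMarginal`),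
`√d · b` is the `E₁`-block of a uniform point on the sphere of radius `√d` of `E₁ ⊕ F`, and
`tvClose_sphereMarginal_stdGaussian`: `|Law(√d·b)(A) − γ_{E₁}(A)| ≤ (k(k+2) + 32·2ᵏ)/d` for every
measurable `A` (`Literature.MeasureTheory.TotalVariation.TVClose`; Diaconis–Freedman 1987, Thm. 1,
real case, with a non-optimal explicit constant — the sharp rate is `2(k+3)/(d−k−3)`).

Proof (one-sided density criterion `tvClose_of_forall_le_add`, as in `BetaGammaRatioTV`): by
`map_sphereMarginalMap_prod_stdGaussian` and a dilation (`map_smul_withDensity`) the law of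
`y = √d b` has density `f = B (1 − ‖y‖²/d)₊^{(m−2)/2}`; with `φ_k = (2π)^{-k/2} e^{-‖y‖²/2}`:
`1 − u ≤ e^{−u}` gives `f ≤ B e^{−(m−2)‖y‖²/(2d)}`, and integrating (`∫ f = 1`, Mathlib's
`GaussianFourier.integral_rexp_neg_mul_sq_norm`) `B(2π)^{k/2} ≥ (1 − (k+2)/d)^{k/2} ≥ 1 − k(k+2)/d`
(Bernoulli); on the bulk `‖y‖² ≤ d/2`, `1 − u ≥ e^{−u−2u²}` gives `f ≥ B(2π)^{k/2} e^{−‖y‖⁴/d} φ_k`,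
whence `φ_k ≤ f + ε φ_k` everywhere with `ε(y) = k(k+2)/d + 32 e^{‖y‖²/4}/d` (`ε ≥ 1` off the
bulk), and `∫ ε φ_k = (k(k+2) + 32·2^{k/2})/d`. No Gamma-function asymptotics are used.
Sources: P. Diaconis, D. Freedman, Ann. Inst. H. Poincaré Probab. Statist. 23 (1987) 397–423,
Thm. 1; É. Borel, Ann. ÉNS 23 (1906) 9–32 (the Maxwell–Borel lemma).
-/

noncomputable section

open MeasureTheory ProbabilityTheory Set Real Metric Module
open scoped ENNReal

namespace Literature.Probability.Distributions

open Literature.MeasureTheory.TotalVariation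

/-! ### Elementary inequalities -/

section Elementary

/-- `(1 - u)^r ≤ e^{-ru}` for `0 ≤ u ≤ 1`, `0 ≤ r` (`log (1 - u) ≤ -u`). [folklore] -/
theorem one_sub_rpow_le_exp {u r : ℝ} (hu1 : u ≤ 1) (hr : 0 ≤ r) :
    (1 - u) ^ r ≤ rexp (-(r * u)) := by
  calc (1 - u) ^ r ≤ (rexp (-u)) ^ r :=
        Real.rpow_le_rpow (by linarith) (Real.one_sub_le_exp_neg u) hr
    _ = rexp (-(r * u)) := by rw [← Real.exp_mul]; ring_nf

/-- `e^{-r(u + 2u²)} ≤ (1 - u)^r` for `0 ≤ u ≤ 1/2`, `0 ≤ r` (`log (1 - u) ≥ -u - 2u²` there).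
[folklore] -/
theorem exp_neg_le_one_sub_rpow {u r : ℝ} (hu0 : 0 ≤ u) (hu1 : u ≤ 1 / 2) (hr : 0 ≤ r) :
    rexp (-(r * (u + 2 * u ^ 2))) ≤ (1 - u) ^ r := by
  calc rexp (-(r * (u + 2 * u ^ 2))) = (rexp (-(u + 2 * u ^ 2))) ^ r := by
        rw [← Real.exp_mul]; ring_nf
    _ ≤ (1 - u) ^ r := Real.rpow_le_rpow (Real.exp_nonneg _) (exp_neg_le_one_sub hu0 hu1) hr

/-- `s² ≤ 32 e^{s/4}` for `s ≥ 0` (`e^v ≥ v²/2` at `v = s/4`). [folklore] -/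
theorem sq_le_exp_quarter {s : ℝ} (hs : 0 ≤ s) : s ^ 2 ≤ 32 * rexp (s / 4) := by
  have h := Real.pow_div_factorial_le_exp (s / 4) (by positivity) 2
  rw [Nat.factorial_two, Nat.cast_ofNat] at h
  linarith [h]

/-- Bernoulli's inequality for the half-integer power: `1 - k t ≤ (1 - t)^{k/2}` for `0 ≤ t < 1`
(`(1-t)^{k/2} ≥ (1-t)^k ≥ 1 - kt`). [folklore] -/
theorem one_sub_mul_le_rpow_half (k : ℕ) {t : ℝ} (ht0 : 0 ≤ t) (ht1 : t < 1) :
    1 - k * t ≤ (1 - t) ^ ((k : ℝ) / 2) := by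
  have hk : (0 : ℝ) ≤ k := Nat.cast_nonneg k
  have h1 : (1 - t) ^ (k : ℝ) ≤ (1 - t) ^ ((k : ℝ) / 2) :=
    Real.rpow_le_rpow_of_exponent_ge (by linarith) (by linarith) (by linarith)
  rw [Real.rpow_natCast] at h1
  have h2 : 1 + (k : ℝ) * (-t) ≤ (1 + (-t)) ^ k := one_add_mul_le_pow (by linarith) k
  calc 1 - k * t = 1 + k * (-t) := by ring
    _ ≤ (1 + (-t)) ^ k := h2
    _ = (1 - t) ^ k := by ring
    _ ≤ _ := h1

/-- The bulk lower bound behind the Diaconis–Freedman comparison: for `0 ≤ s ≤ D/2`, `0 ≤ r`,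
`2r ≤ D`: `e^{-s/2} (1 - s²/D) ≤ (1 - s/D)^r` (via `(1 - u)^r ≥ e^{-r(u + 2u²)}`, `u = s/D`).
[folklore] -/
theorem exp_neg_half_mul_le_one_sub_rpow {D r s : ℝ} (hD0 : 0 < D) (hr0 : 0 ≤ r) (h2r : 2 * r ≤ D)
    (hs0 : 0 ≤ s) (hs1 : s ≤ D / 2) : rexp (-s / 2) * (1 - s ^ 2 / D) ≤ (1 - s / D) ^ r := by
  have hu : s / D ≤ 1 / 2 := by rw [div_le_iff₀ hD0]; linarith
  have hrD : 2 * r / D ≤ 1 := by rw [div_le_one hD0]; exact h2r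
  have step1 : 1 - s ^ 2 / D ≤ rexp (-(s ^ 2 / D)) := by
    linarith [Real.add_one_le_exp (-(s ^ 2 / D))]
  have step2 : rexp (-s / 2) * rexp (-(s ^ 2 / D)) ≤ rexp (-(r * (s / D + 2 * (s / D) ^ 2))) := by
    rw [← Real.exp_add, Real.exp_le_exp]
    have i1 : r * (s / D) ≤ s / 2 := by
      rw [show r * (s / D) = (2 * r / D) * (s / 2) by ring]
      exact mul_le_of_le_one_left (by positivity) hrD
    have i2 : r * (2 * (s / D) ^ 2) ≤ s ^ 2 / D := by
      rw [show r * (2 * (s / D) ^ 2) = (2 * r / D) * (s ^ 2 / D) by rw [div_pow, sq D]; field_simp]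
      exact mul_le_of_le_one_left (by positivity) hrD
    have e : -(r * (s / D + 2 * (s / D) ^ 2)) = -(r * (s / D)) - r * (2 * (s / D) ^ 2) := by ring
    rw [e]
    linarith
  have step3 : rexp (-(r * (s / D + 2 * (s / D) ^ 2))) ≤ (1 - s / D) ^ r :=
    exp_neg_le_one_sub_rpow (by positivity) hu hr0
  calc rexp (-s / 2) * (1 - s ^ 2 / D) ≤ rexp (-s / 2) * rexp (-(s ^ 2 / D)) :=
        mul_le_mul_of_nonneg_left step1 (by positivity)
    _ ≤ rexp (-(r * (s / D + 2 * (s / D) ^ 2))) := step2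
    _ ≤ (1 - s / D) ^ r := step3

/-- Off the bulk the error weight `32 e^{s/4}/D` is at least `1`: if `s > D/2` or `s² > D`
(`D > 0`, `s ≥ 0`). [folklore] -/
theorem one_le_exp_quarter_div {D s : ℝ} (hD0 : 0 < D) (hs0 : 0 ≤ s) (h : D / 2 < s ∨ D < s ^ 2) :
    1 ≤ 32 * rexp (s / 4) / D := by
  rw [le_div_iff₀ hD0, one_mul]
  rcases h with h1 | h1
  · have e0 := Real.add_one_le_exp (D / 8)
    have e1 : rexp (D / 8) ≤ rexp (s / 4) := Real.exp_le_exp.2 (by linarith)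
    linarith
  · have e1 := sq_le_exp_quarter hs0
    linarith

/-- Elementary algebra of the one-sided comparison: if `1 - a ≤ A₀ ≤ 1`, `φ ≥ 0`, `σ ≥ 0`, then
`φ ≤ A₀ φ (1 - σ) + (a + σ) φ`. [folklore] -/
theorem le_mul_mul_one_sub_add {A₀ a φ σ : ℝ} (hA0 : 1 - a ≤ A₀) (hA1 : A₀ ≤ 1) (hφ : 0 ≤ φ)
    (hσ : 0 ≤ σ) : φ ≤ A₀ * φ * (1 - σ) + (a + σ) * φ := by
  have e : A₀ * φ * (1 - σ) + (a + σ) * φ - φ = φ * ((A₀ - (1 - a)) + σ * (1 - A₀)) := by ring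
  have : 0 ≤ φ * ((A₀ - (1 - a)) + σ * (1 - A₀)) :=
    mul_nonneg hφ (add_nonneg (by linarith) (mul_nonneg hσ (by linarith)))
  linarith

end Elementary

/-! ### Dilations and Gaussian integrals on an inner product space -/

section Space

variable {E₁ : Type*} [NormedAddCommGroup E₁] [InnerProductSpace ℝ E₁] [FiniteDimensional ℝ E₁]
  [MeasurableSpace E₁] [BorelSpace E₁]

/-- **Dilating a density.** For `c > 0` and a density `ρ` on a `k`-dimensional real inner product
space, the image of `ρ(b) db` under `b ↦ c • b` is `c^{-k} ρ(y/c) dy`. [folklore] -/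
theorem map_smul_withDensity {ρ : E₁ → ℝ≥0∞} (hρ : Measurable ρ) {c : ℝ} (hc : 0 < c) :
    ((volume : Measure E₁).withDensity ρ).map (fun b => c • b) =
      volume.withDensity fun y => ENNReal.ofReal ((c ^ finrank ℝ E₁)⁻¹) * ρ (c⁻¹ • y) := by
  have hsm : Measurable fun b : E₁ => c • b := measurable_const_smul c
  have hsm' : Measurable fun y : E₁ => c⁻¹ • y := measurable_const_smul c⁻¹
  refine Measure.ext_of_lintegral _ fun g hg => ?_
  have hg' : Measurable fun b : E₁ => g (c • b) := hg.comp hsm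
  have hρ' : Measurable fun y : E₁ => ENNReal.ofReal ((c ^ finrank ℝ E₁)⁻¹) * ρ (c⁻¹ • y) :=
    measurable_const.mul (hρ.comp hsm')
  rw [lintegral_map hg hsm, lintegral_withDensity_eq_lintegral_mul _ hρ hg',
    lintegral_withDensity_eq_lintegral_mul _ hρ' hg]
  simp only [Pi.mul_apply]
  have key := lintegral_comp_smul (E₁ := E₁) (fun b => ρ b * g (c • b)) (inv_ne_zero hc.ne')
  simp only [smul_smul, mul_inv_cancel₀ hc.ne', one_smul] at key
  have hck : ENNReal.ofReal ((c ^ finrank ℝ E₁)⁻¹) *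
      ENNReal.ofReal |((c⁻¹) ^ finrank ℝ E₁)⁻¹| = 1 := by
    rw [inv_pow, inv_inv, abs_of_pos (pow_pos hc _), ← ENNReal.ofReal_mul (by positivity),
      inv_mul_cancel₀ (pow_pos hc _).ne', ENNReal.ofReal_one]
  have hm2 : Measurable fun y : E₁ => ρ (c⁻¹ • y) * g y := (hρ.comp hsm').mul hg
  calc ∫⁻ b, ρ b * g (c • b) = 1 * ∫⁻ b, ρ b * g (c • b) := (one_mul _).symm
    _ = ENNReal.ofReal ((c ^ finrank ℝ E₁)⁻¹) * ∫⁻ y, ρ (c⁻¹ • y) * g y := by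
        rw [← hck, mul_assoc, ← key]
    _ = ∫⁻ y, ENNReal.ofReal ((c ^ finrank ℝ E₁)⁻¹) * ρ (c⁻¹ • y) * g y := by
        rw [← lintegral_const_mul _ hm2]
        simp only [mul_assoc]

/-- `∫⁻ e^{-b‖y‖²} dy = (π/b)^{k/2}` (`ℝ≥0∞` form of Mathlib's
`GaussianFourier.integral_rexp_neg_mul_sq_norm`). [folklore] -/
theorem lintegral_exp_neg_mul_sq_norm {b : ℝ} (hb : 0 < b) :
    ∫⁻ y : E₁, ENNReal.ofReal (rexp (-b * ‖y‖ ^ 2)) =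
      ENNReal.ofReal ((π / b) ^ ((finrank ℝ E₁ : ℝ) / 2)) := by
  have hint := GaussianFourier.integral_rexp_neg_mul_sq_norm (V := E₁) hb
  have hpos : 0 < (π / b) ^ ((finrank ℝ E₁ : ℝ) / 2) := Real.rpow_pos_of_pos (by positivity) _
  have hi : Integrable (fun y : E₁ => rexp (-b * ‖y‖ ^ 2)) :=
    Integrable.of_integral_ne_zero (by rw [hint]; exact hpos.ne')
  rw [← hint, ofReal_integral_eq_lintegral_ofReal hi (ae_of_all _ fun y => (Real.exp_pos _).le)]

/-- The Gaussian density integrates the weight `e^{‖y‖²/4}` to `2^{k/2}`: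
`∫⁻ (2π)^{-k/2} e^{-‖y‖²/4} dy = 2^{k/2}`. [folklore] -/
theorem lintegral_gaussianConst_mul_exp_neg_quarter :
    ∫⁻ y : E₁, ENNReal.ofReal ((2 * π) ^ (-(finrank ℝ E₁ : ℝ) / 2) * rexp (-(1 / 4) * ‖y‖ ^ 2)) =
      ENNReal.ofReal ((2 : ℝ) ^ ((finrank ℝ E₁ : ℝ) / 2)) := by
  have hc : 0 ≤ (2 * π) ^ (-(finrank ℝ E₁ : ℝ) / 2) := by positivity
  simp_rw [ENNReal.ofReal_mul hc]
  rw [lintegral_const_mul _ (by fun_prop), lintegral_exp_neg_mul_sq_norm (by norm_num : (0:ℝ) < 1 / 4),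
    ← ENNReal.ofReal_mul hc]
  congr 1
  rw [show π / (1 / 4) = (2 * π) * 2 by ring, Real.mul_rpow (x := 2 * π) (y := 2) (by positivity) (by norm_num),
    ← mul_assoc, neg_div, Real.rpow_neg (by positivity), inv_mul_cancel₀ (by positivity), one_mul]

end Space

/-! ### The total-variation bound -/

section SphereMarginalTV

variable {E₁ : Type*} [NormedAddCommGroup E₁] [InnerProductSpace ℝ E₁] [FiniteDimensional ℝ E₁]
  [MeasurableSpace E₁] [BorelSpace E₁]
variable {F : Type*} [NormedAddCommGroup F] [InnerProductSpace ℝ F] [FiniteDimensional ℝ F]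
  [MeasurableSpace F] [BorelSpace F]

/-- **Diaconis–Freedman (real case, explicit rate).** For independent standard Gaussian vectors
`x ∈ E₁`, `z ∈ F` (`k = dim E₁`, `m = dim F ≥ 3`, `d = k + m`) and `b = x/√(‖x‖² + ‖z‖²)`, the law of
`√d · b` — the first `k` coordinates of a uniform point on the sphere of radius `√d` in `ℝᵈ` — is
within `(k(k+2) + 32·2ᵏ)/d` of the standard Gaussian of `E₁` on every measurable set.
[cite: DiaconisFreedman1987, Thm 1] -/
theorem tvClose_sphereMarginal_stdGaussian (hF : 3 ≤ finrank ℝ F) :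
    TVClose
      ((((stdGaussian E₁).prod (stdGaussian F)).map (sphereMarginalMap E₁ F)).map
        (fun b => Real.sqrt (↑(finrank ℝ E₁ + finrank ℝ F)) • b))
      (stdGaussian E₁)
      (((finrank ℝ E₁ : ℝ) * (finrank ℝ E₁ + 2) + 32 * 2 ^ finrank ℝ E₁) /
        ↑(finrank ℝ E₁ + finrank ℝ F)) := by
  haveI : Nontrivial F := Module.nontrivial_of_finrank_pos (R := ℝ) (by omega)
  have hD0 : (0 : ℝ) < ↑(finrank ℝ E₁ + finrank ℝ F) := by exact_mod_cast (by omega : 0 < finrank ℝ E₁ + finrank ℝ F)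
  -- instantiate the analytic inputs, then introduce notation
  obtain ⟨K, hK0, hlaw⟩ := map_sphereMarginalMap_prod_stdGaussian (E₁ := E₁) (F := F)
  have hγ_eq := stdGaussian_eq_withDensity (E := E₁)
  have hquart := lintegral_gaussianConst_mul_exp_neg_quarter (E₁ := E₁)
  have hm3 : (3 : ℝ) ≤ finrank ℝ F := by exact_mod_cast hF
  have hrD : (0 : ℝ) < ((finrank ℝ F : ℝ) / 2 - 1) / ↑(finrank ℝ E₁ + finrank ℝ F) :=
    div_pos (by linarith) hD0
  have hgauss := lintegral_exp_neg_mul_sq_norm (E₁ := E₁) hrD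
  have hscale := map_smul_withDensity (E₁ := E₁)
    (ρ := fun b => ENNReal.ofReal (K * sphereMarginalDensity (finrank ℝ F) b)) (by fun_prop)
    (Real.sqrt_pos.2 hD0)
  set k : ℕ := finrank ℝ E₁ with hk
  set m : ℕ := finrank ℝ F with hm
  set D : ℝ := ((k + m : ℕ) : ℝ) with hD
  have hD' : D = (k : ℝ) + m := by rw [hD]; push_cast; rfl
  have hk0 : (0 : ℝ) ≤ k := Nat.cast_nonneg k
  set r : ℝ := (m : ℝ) / 2 - 1 with hr
  have hr0 : 0 ≤ r := by rw [hr]; linarith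
  have h2r : 2 * r ≤ D := by rw [hr, hD']; linarith
  set t : ℝ := ((k : ℝ) + 2) / D with ht
  have ht0 : 0 ≤ t := by positivity
  have ht1 : t < 1 := by rw [ht, div_lt_one hD0, hD']; linarith
  have h2rD : 2 * r / D = 1 - t := by
    rw [eq_sub_iff_add_eq, ht, ← add_div, div_eq_one_iff_eq hD0.ne', hr, hD']; ring
  set c : ℝ := Real.sqrt D with hc
  have hc0 : 0 < c := Real.sqrt_pos.2 hD0
  have hcc : c ^ 2 = D := Real.sq_sqrt hD0.le
  set B : ℝ := (c ^ k)⁻¹ * K with hB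
  have hB0 : 0 < B := by positivity
  set fR : E₁ → ℝ := fun y => B * sphereMarginalDensity m (c⁻¹ • y) with hfR
  set cst : ℝ := (2 * π) ^ (-(k : ℝ) / 2) with hcst
  have hcst0 : 0 < cst := Real.rpow_pos_of_pos (by positivity) _
  have hcst1 : cst * (2 * π) ^ ((k : ℝ) / 2) = 1 := by
    rw [hcst, neg_div, Real.rpow_neg (by positivity), inv_mul_cancel₀ (by positivity)]
  set φR : E₁ → ℝ := fun y => cst * rexp (-‖y‖ ^ 2 / 2) with hφR
  set Dt : Measure E₁ := ((((stdGaussian E₁).prod (stdGaussian F)).map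
    (sphereMarginalMap E₁ F)).map (fun b => c • b)) with hDt
  clear_value k m D r t c B cst
  -- the two measures as densities
  have hDt_eq : Dt = volume.withDensity fun y => ENNReal.ofReal (fR y) := by
    rw [hDt, hlaw, hscale]
    congr 1
    funext y
    rw [hfR]; dsimp only; rw [hB, mul_assoc, ENNReal.ofReal_mul (p := (c ^ k)⁻¹) (by positivity)]
  clear_value fR φR Dt
  have hγ_eq' : stdGaussian E₁ = (volume : Measure E₁).withDensity fun y => ENNReal.ofReal (φR y) := by
    rw [hφR]; exact hγ_eq
  haveI hDtP : IsProbabilityMeasure Dt := by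
    rw [hDt, Measure.map_map (measurable_const_smul c) (by fun_prop)]
    exact Measure.isProbabilityMeasure_map (by fun_prop)
  have hmass_f : ∫⁻ y, ENNReal.ofReal (fR y) = 1 := by
    have h1 : Dt univ = 1 := measure_univ
    rwa [hDt_eq, withDensity_apply _ MeasurableSet.univ, Measure.restrict_univ] at h1
  have hmass_φ : ∫⁻ y, ENNReal.ofReal (φR y) = 1 := by
    have h1 : stdGaussian E₁ univ = 1 := measure_univ
    rwa [hγ_eq', withDensity_apply _ MeasurableSet.univ, Measure.restrict_univ] at h1
  -- the scaled argument
  have hnorm : ∀ y : E₁, ‖c⁻¹ • y‖ ^ 2 = ‖y‖ ^ 2 / D := fun y => by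
    rw [norm_smul, norm_inv, Real.norm_of_nonneg hc0.le, mul_pow, inv_pow, hcc, div_eq_inv_mul]
  have hsupp : ∀ y : E₁, ‖c⁻¹ • y‖ < 1 ↔ ‖y‖ ^ 2 < D := fun y => by
    rw [← sq_lt_one_iff₀ (norm_nonneg _), hnorm, div_lt_one hD0]
  have hf0 : ∀ y, 0 ≤ fR y := fun y => by
    rw [hfR]; exact mul_nonneg hB0.le (sphereMarginalDensity_nonneg _ _)
  have hφ0 : ∀ y, 0 < φR y := fun y => by rw [hφR]; exact mul_pos hcst0 (Real.exp_pos _)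
  -- upper bound `f ≤ B e^{-(r/D)‖y‖²}` everywhere
  have hupper : ∀ y : E₁, fR y ≤ B * rexp (-(r / D) * ‖y‖ ^ 2) := by
    intro y
    rw [hfR]; dsimp only; refine mul_le_mul_of_nonneg_left ?_ hB0.le
    unfold sphereMarginalDensity
    split_ifs with hy
    · rw [hnorm, ← hr]
      have hu1 : ‖y‖ ^ 2 / D ≤ 1 := ((div_lt_one hD0).2 ((hsupp y).1 hy)).le
      calc (1 - ‖y‖ ^ 2 / D) ^ r ≤ rexp (-(r * (‖y‖ ^ 2 / D))) := one_sub_rpow_le_exp hu1 hr0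
        _ = rexp (-(r / D) * ‖y‖ ^ 2) := by congr 1; ring
    · exact (Real.exp_pos _).le
  -- hence `A := B / cst ≥ (1 - t)^{k/2}`
  have hA : (1 - t) ^ ((k : ℝ) / 2) ≤ B / cst := by
    have h1 : (1 : ℝ≥0∞) ≤ ENNReal.ofReal B * ∫⁻ y : E₁, ENNReal.ofReal (rexp (-(r / D) * ‖y‖ ^ 2)) := by
      rw [← hmass_f, ← lintegral_const_mul' _ _ ENNReal.ofReal_ne_top]
      refine lintegral_mono fun y => ?_
      rw [← ENNReal.ofReal_mul hB0.le]
      exact ENNReal.ofReal_le_ofReal (hupper y)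
    rw [hgauss, ← ENNReal.ofReal_mul hB0.le, ENNReal.one_le_ofReal] at h1
    have h3 : π / (r / D) = (2 * π) / (1 - t) := by rw [← h2rD]; field_simp
    rw [h3, Real.div_rpow (by positivity) (by linarith), ← mul_div_assoc,
      one_le_div (Real.rpow_pos_of_pos (by linarith) _)] at h1
    calc (1 - t) ^ ((k : ℝ) / 2) ≤ B * (2 * π) ^ ((k : ℝ) / 2) := h1
      _ = B / cst := by rw [eq_div_iff hcst0.ne', mul_assoc, mul_comm _ cst, hcst1, mul_one]
  -- Bernoulli
  set a : ℝ := k * t with ha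
  clear_value a
  have ha0 : 0 ≤ a := by rw [ha]; exact mul_nonneg hk0 ht0
  have hA0 : 1 - a ≤ (1 - t) ^ ((k : ℝ) / 2) := by rw [ha]; exact one_sub_mul_le_rpow_half k ht0 ht1
  have hA1 : (1 - t) ^ ((k : ℝ) / 2) ≤ 1 := Real.rpow_le_one (by linarith) (by linarith) (by positivity)
  -- the error function and the pointwise comparison `φ ≤ f + ε φ`
  set εR : E₁ → ℝ := fun y => a + 32 * rexp (‖y‖ ^ 2 / 4) / D with hεR
  clear_value εR
  have hpt : ∀ y, φR y ≤ fR y + εR y * φR y := by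
    intro y
    have hφy := hφ0 y
    have hs0 : 0 ≤ ‖y‖ ^ 2 := sq_nonneg _
    by_cases hcase : ‖y‖ ^ 2 ≤ D / 2 ∧ (‖y‖ ^ 2) ^ 2 ≤ D
    · obtain ⟨hs1, hs2⟩ := hcase
      have hlt : ‖c⁻¹ • y‖ < 1 := (hsupp y).2 (by linarith)
      have hfval : fR y = B * (1 - ‖y‖ ^ 2 / D) ^ r := by
        rw [hfR]; dsimp only; rw [sphereMarginalDensity, if_pos hlt, hnorm, ← hr]
      -- lower bound on `f` on the bulk
      have hlow : B / cst * φR y * (1 - (‖y‖ ^ 2) ^ 2 / D) ≤ fR y := by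
        rw [hfval]
        have e1 : B / cst * φR y = B * rexp (-‖y‖ ^ 2 / 2) := by
          rw [hφR]; dsimp only; field_simp
        rw [e1, mul_assoc]
        exact mul_le_mul_of_nonneg_left (exp_neg_half_mul_le_one_sub_rpow hD0 hr0 h2r hs0 hs1) hB0.le
      have hsD : 0 ≤ 1 - (‖y‖ ^ 2) ^ 2 / D := by rw [sub_nonneg, div_le_one hD0]; exact hs2
      have hεge : a + (‖y‖ ^ 2) ^ 2 / D ≤ εR y := by
        rw [hεR]; dsimp only
        have h32 : (‖y‖ ^ 2) ^ 2 / D ≤ 32 * rexp (‖y‖ ^ 2 / 4) / D :=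
          div_le_div_of_nonneg_right (sq_le_exp_quarter hs0) hD0.le
        linarith
      have hAφ : (1 - t) ^ ((k : ℝ) / 2) * φR y * (1 - (‖y‖ ^ 2) ^ 2 / D) ≤ fR y :=
        le_trans (mul_le_mul_of_nonneg_right (mul_le_mul_of_nonneg_right hA hφy.le) hsD) hlow
      calc φR y ≤ (1 - t) ^ ((k : ℝ) / 2) * φR y * (1 - (‖y‖ ^ 2) ^ 2 / D) +
            (a + (‖y‖ ^ 2) ^ 2 / D) * φR y :=
            le_mul_mul_one_sub_add hA0 hA1 hφy.le (div_nonneg (by positivity) hD0.le)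
        _ ≤ fR y + εR y * φR y := add_le_add hAφ (mul_le_mul_of_nonneg_right hεge hφy.le)
    · have hε1 : 1 ≤ εR y := by
        rw [hεR]; dsimp only
        have h1 : D / 2 < ‖y‖ ^ 2 ∨ D < (‖y‖ ^ 2) ^ 2 := by
          rcases not_and_or.1 hcase with h1 | h1
          exacts [Or.inl (not_le.1 h1), Or.inr (not_le.1 h1)]
        linarith [one_le_exp_quarter_div hD0 hs0 h1]
      calc φR y = 1 * φR y := (one_mul _).symm
        _ ≤ εR y * φR y := mul_le_mul_of_nonneg_right hε1 hφy.le
        _ ≤ fR y + εR y * φR y := le_add_of_nonneg_left (hf0 y)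
  -- the integral of `ε φ`
  have hεφ : ∀ y, ENNReal.ofReal (εR y * φR y) = ENNReal.ofReal a * ENNReal.ofReal (φR y) +
      ENNReal.ofReal (32 / D) * ENNReal.ofReal (cst * rexp (-(1 / 4) * ‖y‖ ^ 2)) := by
    intro y
    have e : rexp (‖y‖ ^ 2 / 4) * rexp (-‖y‖ ^ 2 / 2) = rexp (-(1 / 4) * ‖y‖ ^ 2) := by
      rw [← Real.exp_add]; congr 1; ring
    have e2 : εR y * φR y = a * φR y + 32 / D * (cst * rexp (-(1 / 4) * ‖y‖ ^ 2)) := by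
      rw [hεR, hφR]; dsimp only; rw [← e]; ring
    have h32 : (0 : ℝ) ≤ 32 / D := div_nonneg (by norm_num) hD0.le
    rw [e2, ENNReal.ofReal_add (mul_nonneg ha0 (hφ0 y).le)
      (mul_nonneg h32 (mul_nonneg hcst0.le (Real.exp_pos _).le)),
      ENNReal.ofReal_mul (p := a) ha0, ENNReal.ofReal_mul (p := 32 / D) h32]
  have hmφ : Measurable fun y => ENNReal.ofReal (φR y) := by rw [hφR]; fun_prop
  have hmq : Measurable fun y : E₁ => ENNReal.ofReal (cst * rexp (-(1 / 4) * ‖y‖ ^ 2)) := by fun_prop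
  have hδ : ∫⁻ y, ENNReal.ofReal (εR y * φR y) = ENNReal.ofReal (a + 32 / D * 2 ^ ((k : ℝ) / 2)) := by
    simp_rw [hεφ]
    rw [lintegral_add_left (hmφ.const_mul _), lintegral_const_mul _ hmφ,
      lintegral_const_mul _ hmq, hmass_φ, mul_one, hquart,
      ← ENNReal.ofReal_mul (div_nonneg (by norm_num) hD0.le),
      ← ENNReal.ofReal_add ha0 (mul_nonneg (div_nonneg (by norm_num) hD0.le) (by positivity))]
  have hδ_le : a + 32 / D * 2 ^ ((k : ℝ) / 2) ≤ ((k : ℝ) * (k + 2) + 32 * 2 ^ k) / D := by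
    have h2k : (2 : ℝ) ^ ((k : ℝ) / 2) ≤ 2 ^ k := by
      calc (2 : ℝ) ^ ((k : ℝ) / 2) ≤ 2 ^ (k : ℝ) :=
            Real.rpow_le_rpow_of_exponent_le (by norm_num) (by linarith)
        _ = 2 ^ k := Real.rpow_natCast 2 k
    rw [ha, ht, show (k : ℝ) * ((k + 2) / D) + 32 / D * 2 ^ ((k : ℝ) / 2) =
      ((k : ℝ) * (k + 2) + 32 * 2 ^ ((k : ℝ) / 2)) / D by ring]
    exact div_le_div_of_nonneg_right (by linarith) hD0.le
  have hδ0 : 0 ≤ ((k : ℝ) * (k + 2) + 32 * 2 ^ k) / D := div_nonneg (by positivity) hD0.le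
  have hmε : Measurable fun y => ENNReal.ofReal (εR y * φR y) := by rw [hεR, hφR]; fun_prop
  -- the one-sided criterion
  have hptE : ∀ y, ENNReal.ofReal (φR y) ≤ ENNReal.ofReal (fR y) + ENNReal.ofReal (εR y * φR y) := by
    intro y
    have hε0 : 0 ≤ εR y := by rw [hεR]; exact add_nonneg ha0 (div_nonneg (by positivity) hD0.le)
    rw [← ENNReal.ofReal_add (hf0 y) (mul_nonneg hε0 (hφ0 y).le)]
    exact ENNReal.ofReal_le_ofReal (hpt y)
  have key : TVClose Dt (stdGaussian E₁)
      (ENNReal.ofReal (((k : ℝ) * (k + 2) + 32 * 2 ^ k) / D)).toReal := by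
    refine tvClose_of_forall_le_add ENNReal.ofReal_ne_top fun E hE => ?_
    rw [hγ_eq', withDensity_apply _ hE, hDt_eq, withDensity_apply _ hE]
    refine le_trans (lintegral_mono fun y => hptE y) ?_
    rw [lintegral_add_right _ hmε]
    refine add_le_add le_rfl (le_trans (lintegral_mono' Measure.restrict_le_self le_rfl) ?_)
    rw [hδ]
    exact ENNReal.ofReal_le_ofReal hδ_le
  rw [ENNReal.toReal_ofReal hδ0] at key
  exact key

end SphereMarginalTV

end Literature.Probability.Distributions

end
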